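import Literature.Analysis.Matrix.RegulatorRenormalisation
import Literature.MathematicalPhysics.QuantumFieldTheory.GaussianToolkit
import Literature.LinearAlgebra.Matrix.DeterminantLowRankDefect
import Literature.Analysis.Matrix.DeterminantDefectInequality
import HarnessLib

/-!
# Subcriticality of a quadratic regulator propagates along the exact renormalisation flow

Companion of `RegulatorRenormalisation.lean` (the algebra `M ↦ M′ = M(1 − CM)⁻¹`) and of
`Literature/Probability/Distributions/GaussianQuadraticTilt.lean` (the Gaussian integral
`E_{N(0,C)} e^{½(x+φ)ᵀM(x+φ)} = det(1 − CM)^{−1/2} e^{½ φᵀM′φ}`, valid under the **subcriticality**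
hypothesis `1 − √C M √C ≻ 0`). For real matrices, a positive semidefinite regulator `M` and positive
semidefinite covariances:

* `posDef_one_sub_mul_transpose` — the flip `1 − XᵀX ≻ 0 ⟹ 1 − XXᵀ ≻ 0` (elementary, by Cauchy–Schwarz);
* `posDef_one_sub_sqrt_mul_sqrt_iff` — `1 − √C M √C ≻ 0 ↔ 1 − √M C √M ≻ 0`;
* `posDef_one_sub_sqrt_mul_sqrt_mono` — subcriticality is MONOTONE in the covariance:
  `C₁ ⪯ C`, `1 − √C M √C ≻ 0 ⟹ 1 − √C₁ M √C₁ ≻ 0` ("finiteness at every scale is automatic from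
  global subcriticality");
* `regulator_step` — **the step**: if `1 − √(C₁+C₂) M √(C₁+C₂) ≻ 0` then `1 − √C₁ M √C₁ ≻ 0`,
  `1 − C₁M` is invertible, the renormalised regulator `M′ = M(1 − C₁M)⁻¹` is again symmetric positive
  semidefinite, and it is subcritical for the REMAINING covariance: `1 − √C₂ M′ √C₂ ≻ 0`;
* `regFlow_posSemidef_and_subcritical` — by induction along `C = Σ_{j<n} Cⱼ`: every stage
  `Mⱼ = regFlow C M j` of the flow is positive semidefinite and subcritical for `Σ_{j ≤ i < n} Cᵢ`, so the
  Gaussian integral of `GaussianQuadraticTilt` applies scale by scale and (by `prod_det_regFlow`) the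
  per-scale determinants multiply to the global one.

* quantitative versions: `posSemidef_smul_one_sub_mul_transpose` (flip with a margin),
  `posSemidef_smul_one_sub_sqrt_mul_sqrt_symm/_mono`, `regulator_step_margin`, `regFlow_margin`,
  `regFlow_step_margin` — an `ε`-MARGIN `(1−ε)·1 − √C M √C ⪰ 0` propagates along the flow (the
  renormalised regulator stays `(1−ε)`-subcritical at every scale) — and `pow_le_det_one_sub_mul`:
  `ε^{rank M} ≤ det(1 − CM)` for a possibly SINGULAR `C ⪰ 0` (from the tree's
  `DeterminantLowRankDefect.det_one_sub_ge_pow`);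
* `det_one_sub_mul_add_le` — merging never loses: `det(1 − C(M_X+M_Y)) ≤ det(1 − CM_X)·det(1 − CM_Y)`
  (regulator form of `DeterminantDefectInequality.det_one_sub_sub_le`).

All [folklore] (semigroup property of Gaussian convolution; cf.
[cite: BauerschmidtBrydgesSlade2019Gaussian, Ch. 2 (progressive Gaussian integration)]). Context: the
`(1−ε₀)`-critical large-field regulator of the line `fat-gaussian-defect-calculus` of crux
`BalabanIR.BirComplexStableXYR` (Hubbard summit), card fact (α).
-/

noncomputable section

open Matrix
open scoped BigOperators MatrixOrder
open Literature.MathematicalPhysics.QuantumFieldTheory.GaussianToolkit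

namespace Literature.Analysis.Matrix

variable {ι : Type*} [Fintype ι] [DecidableEq ι]

/-! ### Generalities on real positive (semi)definite matrices -/

/-- `√S` is positive semidefinite. [folklore] -/
theorem posSemidef_cfcSqrt (S : Matrix ι ι ℝ) : (CFC.sqrt S).PosSemidef :=
  Matrix.nonneg_iff_posSemidef.mp (CFC.sqrt_nonneg S)

omit [DecidableEq ι] in
/-- Real positive definiteness from the real quadratic form. [folklore] -/
theorem posDef_of_transpose_of_pos {P : Matrix ι ι ℝ} (hPT : Pᵀ = P) (h : ∀ y, y ≠ 0 → 0 < y ⬝ᵥ P *ᵥ y) :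
    P.PosDef := by
  refine Matrix.PosDef.of_dotProduct_mulVec_pos ?_ fun y hy => ?_
  · rw [Matrix.IsHermitian, Matrix.conjTranspose_eq_transpose_of_trivial, hPT]
  · rw [star_trivial]; exact h y hy

/-! ### The flip -/

omit [DecidableEq ι] in
/-- `(Xᵀy)·(Xᵀy) = y·(X Xᵀ y)`. [folklore] -/
theorem transpose_mulVec_dotProduct_self (X : Matrix ι ι ℝ) (y : ι → ℝ) :
    (Xᵀ *ᵥ y) ⬝ᵥ (Xᵀ *ᵥ y) = y ⬝ᵥ (X * Xᵀ) *ᵥ y := by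
  rw [← Matrix.mulVec_mulVec, Matrix.dotProduct_mulVec y X, ← Matrix.mulVec_transpose]

/-- **The flip**: for a real square matrix `X`, `1 − XᵀX ≻ 0` implies `1 − XXᵀ ≻ 0` (both say
`‖X‖ < 1`; elementary proof by Cauchy–Schwarz). [folklore] -/
theorem posDef_one_sub_mul_transpose {X : Matrix ι ι ℝ} (h : (1 - Xᵀ * X).PosDef) :
    (1 - X * Xᵀ).PosDef := by
  have hyp : ∀ z : ι → ℝ, z ≠ 0 → (X *ᵥ z) ⬝ᵥ (X *ᵥ z) < z ⬝ᵥ z := fun z hz => by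
    have h1 := h.dotProduct_mulVec_pos hz
    rw [star_trivial, Matrix.sub_mulVec, Matrix.one_mulVec, dotProduct_sub, ← Matrix.mulVec_mulVec,
      Matrix.dotProduct_mulVec z Xᵀ, ← Matrix.mulVec_transpose, Matrix.transpose_transpose] at h1
    linarith
  refine posDef_of_transpose_of_pos ?_ fun y hy => ?_
  · rw [Matrix.transpose_sub, Matrix.transpose_one, Matrix.transpose_mul, Matrix.transpose_transpose]
  rw [Matrix.sub_mulVec, Matrix.one_mulVec, dotProduct_sub, ← transpose_mulVec_dotProduct_self, sub_pos]
  -- `0 < v·v` for `v ≠ 0` (tree: e.g. `AHRiccati.dotProduct_self_pos'`; inlined to keep imports light)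
  have hpos : ∀ v : ι → ℝ, v ≠ 0 → 0 < v ⬝ᵥ v := fun v hv => by
    have h := Matrix.PosDef.one.dotProduct_mulVec_pos (M := (1 : Matrix ι ι ℝ)) hv
    rwa [star_trivial, Matrix.one_mulVec] at h
  set z := Xᵀ *ᵥ y with hz
  have hyy : 0 < y ⬝ᵥ y := hpos y hy
  by_cases hz0 : z = 0
  · rwa [hz0, zero_dotProduct]
  · -- `(z·z)² = (y·Xz)² ≤ (y·y)(Xz·Xz) < (y·y)(z·z)` forces `z·z < y·y`
    have hzpos : 0 < z ⬝ᵥ z := hpos z hz0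
    have hzz : z ⬝ᵥ z = y ⬝ᵥ (X *ᵥ z) := by
      rw [hz, Matrix.dotProduct_mulVec y X, ← Matrix.mulVec_transpose]
    have hCS := dotProduct_mulVec_sq_le (P := (1 : Matrix ι ι ℝ)) Matrix.transpose_one
      (fun v => by rw [Matrix.one_mulVec]; exact Finset.sum_nonneg fun i _ => mul_self_nonneg (v i))
      y (X *ᵥ z)
    simp only [Matrix.one_mulVec] at hCS
    rw [← hzz] at hCS
    have hXz := hyp z hz0
    by_contra hcon
    push Not at hcon
    nlinarith [mul_lt_mul_of_pos_left hXz hyy, mul_le_mul_of_nonneg_right hcon hzpos.le]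

/-! ### Subcriticality in the two symmetric forms, and its monotonicity in the covariance -/

/-- `√C M √C = (√M √C)ᵀ(√M √C)` for `M ⪰ 0`. [folklore] -/
theorem sqrt_mul_mul_sqrt_eq_transpose_mul_self {C M : Matrix ι ι ℝ} (hM : M.PosSemidef) :
    CFC.sqrt C * M * CFC.sqrt C = (CFC.sqrt M * CFC.sqrt C)ᵀ * (CFC.sqrt M * CFC.sqrt C) := by
  rw [Matrix.transpose_mul, transpose_sqrt (S := M), transpose_sqrt (S := C)]
  simp only [Matrix.mul_assoc]
  rw [← Matrix.mul_assoc (CFC.sqrt M) (CFC.sqrt M) (CFC.sqrt C), CFC.sqrt_mul_sqrt_self M hM.nonneg]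

/-- `(√M √C)(√M √C)ᵀ = √M C √M` for `C ⪰ 0`. [folklore] -/
theorem mul_self_transpose_eq_sqrt_mul_mul_sqrt {C M : Matrix ι ι ℝ} (hC : C.PosSemidef) :
    (CFC.sqrt M * CFC.sqrt C) * (CFC.sqrt M * CFC.sqrt C)ᵀ = CFC.sqrt M * C * CFC.sqrt M := by
  rw [Matrix.transpose_mul, transpose_sqrt (S := M), transpose_sqrt (S := C)]
  simp only [Matrix.mul_assoc]
  rw [← Matrix.mul_assoc (CFC.sqrt C) (CFC.sqrt C) (CFC.sqrt M), CFC.sqrt_mul_sqrt_self C hC.nonneg]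

/-- One direction of the symmetry `C ↔ M` of subcriticality: for `C, M ⪰ 0`,
`1 − √C M √C ≻ 0 ⟹ 1 − √M C √M ≻ 0`. [folklore] -/
theorem posDef_one_sub_sqrt_mul_sqrt_symm {C M : Matrix ι ι ℝ} (hC : C.PosSemidef) (hM : M.PosSemidef)
    (h : (1 - CFC.sqrt C * M * CFC.sqrt C).PosDef) : (1 - CFC.sqrt M * C * CFC.sqrt M).PosDef := by
  rw [sqrt_mul_mul_sqrt_eq_transpose_mul_self hM] at h
  rw [← mul_self_transpose_eq_sqrt_mul_mul_sqrt hC]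
  exact posDef_one_sub_mul_transpose h

/-- **Subcriticality is symmetric in covariance and regulator**: for `C, M ⪰ 0`,
`1 − √C M √C ≻ 0 ↔ 1 − √M C √M ≻ 0`. [folklore] -/
theorem posDef_one_sub_sqrt_mul_sqrt_iff {C M : Matrix ι ι ℝ} (hC : C.PosSemidef) (hM : M.PosSemidef) :
    (1 - CFC.sqrt C * M * CFC.sqrt C).PosDef ↔ (1 - CFC.sqrt M * C * CFC.sqrt M).PosDef :=
  ⟨posDef_one_sub_sqrt_mul_sqrt_symm hC hM, posDef_one_sub_sqrt_mul_sqrt_symm hM hC⟩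

/-- `(√M)ᴴ = √M` (real matrices). [folklore] -/
theorem conjTranspose_cfcSqrt (M : Matrix ι ι ℝ) : (CFC.sqrt M)ᴴ = CFC.sqrt M := by
  rw [Matrix.conjTranspose_eq_transpose_of_trivial, transpose_sqrt (S := M)]

/-- **Subcriticality is monotone in the covariance** ("finiteness at every scale from global
subcriticality"): for `0 ⪯ C₁ ⪯ C` and `M ⪰ 0`, `1 − √C M √C ≻ 0 ⟹ 1 − √C₁ M √C₁ ≻ 0`. [folklore] -/
theorem posDef_one_sub_sqrt_mul_sqrt_mono {C C₁ M : Matrix ι ι ℝ} (hC₁ : C₁.PosSemidef)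
    (hCC₁ : (C - C₁).PosSemidef) (hM : M.PosSemidef) (h : (1 - CFC.sqrt C * M * CFC.sqrt C).PosDef) :
    (1 - CFC.sqrt C₁ * M * CFC.sqrt C₁).PosDef := by
  have hC : C.PosSemidef := by
    have := hC₁.add hCC₁
    rwa [add_sub_cancel] at this
  have h1 : (1 - CFC.sqrt M * C * CFC.sqrt M).PosDef := posDef_one_sub_sqrt_mul_sqrt_symm hC hM h
  have h2 : (1 - CFC.sqrt M * C₁ * CFC.sqrt M).PosDef := by
    have hpsd : ((CFC.sqrt M)ᴴ * (C - C₁) * CFC.sqrt M).PosSemidef := hCC₁.conjTranspose_mul_mul_same _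
    rw [conjTranspose_cfcSqrt] at hpsd
    have := h1.add_posSemidef hpsd
    convert this using 1
    rw [Matrix.mul_sub, Matrix.sub_mul]
    abel
  exact posDef_one_sub_sqrt_mul_sqrt_symm hM hC₁ h2

/-! ### The renormalisation step -/

/-- `det(1 − CM) = det(1 − √C M √C)` for `C ⪰ 0`. [folklore] -/
theorem det_one_sub_mul_eq_det_one_sub_sqrt_mul_sqrt {C : Matrix ι ι ℝ} (hC : C.PosSemidef)
    (M : Matrix ι ι ℝ) : (1 - C * M).det = (1 - CFC.sqrt C * M * CFC.sqrt C).det := by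
  conv_lhs => rw [← CFC.sqrt_mul_sqrt_self C hC.nonneg, Matrix.mul_assoc, Matrix.det_one_sub_mul_comm]

/-- **The renormalisation step preserves the regulator class.** For `C₁, C₂, M ⪰ 0` with
`1 − √(C₁+C₂) M √(C₁+C₂) ≻ 0`: (a) `1 − √C₁ M √C₁ ≻ 0`; (b) `1 − C₁M` is invertible;
(c) `M′ = M(1 − C₁M)⁻¹ ⪰ 0` (in particular symmetric); (d) `1 − √C₂ M′ √C₂ ≻ 0`. [folklore] -/
theorem regulator_step {C₁ C₂ M : Matrix ι ι ℝ} (hC₁ : C₁.PosSemidef) (hC₂ : C₂.PosSemidef)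
    (hM : M.PosSemidef) (h : (1 - CFC.sqrt (C₁ + C₂) * M * CFC.sqrt (C₁ + C₂)).PosDef) :
    (1 - CFC.sqrt C₁ * M * CFC.sqrt C₁).PosDef ∧ IsUnit (1 - C₁ * M).det ∧
      (M * (1 - C₁ * M)⁻¹).PosSemidef ∧
      (1 - CFC.sqrt C₂ * (M * (1 - C₁ * M)⁻¹) * CFC.sqrt C₂).PosDef := by
  -- (a)
  have ha : (1 - CFC.sqrt C₁ * M * CFC.sqrt C₁).PosDef :=
    posDef_one_sub_sqrt_mul_sqrt_mono hC₁ (by rwa [add_sub_cancel_left]) hM h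
  -- (b)
  have hb : IsUnit (1 - C₁ * M).det := by
    rw [det_one_sub_mul_eq_det_one_sub_sqrt_mul_sqrt hC₁]
    exact ha.isUnit.map Matrix.detMonoidHom
  -- (c): `M′ = N P⁻¹ N`, `N = √M`, `P = 1 − N C₁ N ≻ 0`
  set N := CFC.sqrt M with hNdef
  have hNN : N * N = M := CFC.sqrt_mul_sqrt_self M hM.nonneg
  have hNH : Nᴴ = N := conjTranspose_cfcSqrt M
  have hP : (1 - N * C₁ * N).PosDef := posDef_one_sub_sqrt_mul_sqrt_symm hC₁ hM ha
  have hPu : IsUnit (1 - N * C₁ * N).det := hP.isUnit.map Matrix.detMonoidHom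
  have hb' : IsUnit (1 - C₁ * N * N).det := by rwa [Matrix.mul_assoc, hNN]
  have hM' : M * (1 - C₁ * M)⁻¹ = N * (1 - N * C₁ * N)⁻¹ * N := by
    rw [← hNN, Matrix.mul_assoc N N, ← Matrix.mul_assoc C₁ N N, mul_inv_one_sub_mul hb',
      ← Matrix.mul_assoc, ← Matrix.mul_assoc N]
  have hc : (M * (1 - C₁ * M)⁻¹).PosSemidef := by
    rw [hM']
    have := hP.inv.posSemidef.conjTranspose_mul_mul_same N
    rwa [hNH] at this
  refine ⟨ha, hb, hc, ?_⟩
  -- (d): `Q = √(P⁻¹)`, `Y = Q N √C₂`; `1 − YYᵀ = Q(P − N C₂ N)Q ≻ 0`, flip, `YᵀY = √C₂ M′ √C₂`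
  have hPinv : (1 - N * C₁ * N)⁻¹.PosDef := hP.inv
  set Q := CFC.sqrt (1 - N * C₁ * N)⁻¹ with hQdef
  have hQQ : Q * Q = (1 - N * C₁ * N)⁻¹ := sqrt_mul_sqrt hPinv
  have hQT : Qᵀ = Q := transpose_sqrt (S := (1 - N * C₁ * N)⁻¹)
  have hQu : IsUnit Q := isUnit_sqrt hPinv
  have hQdu : IsUnit Q.det := (Matrix.isUnit_iff_isUnit_det Q).1 hQu
  have hC₁₂ : (C₁ + C₂).PosSemidef := hC₁.add hC₂
  -- `1 − N(C₁+C₂)N ≻ 0`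
  have hglob : (1 - N * (C₁ + C₂) * N).PosDef := posDef_one_sub_sqrt_mul_sqrt_symm hC₁₂ hM h
  -- `(P⁻¹)⁻¹ − N C₂ N = 1 − N(C₁+C₂)N`
  have hd1 : ((1 - N * C₁ * N)⁻¹⁻¹ - N * C₂ * N).PosDef := by
    rw [Matrix.nonsing_inv_nonsing_inv _ hPu]
    convert hglob using 1
    rw [Matrix.mul_add, Matrix.add_mul]
    abel
  -- congruence by `Q`
  have hd2 : (1 - Q * N * C₂ * N * Q).PosDef := by
    have hcong := hd1.conjTranspose_mul_mul_same (B := Q) (Matrix.mulVec_injective_of_isUnit hQu)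
    rw [Matrix.conjTranspose_eq_transpose_of_trivial, hQT, Matrix.mul_sub, Matrix.sub_mul,
      ← sqrt_inv_mul_sqrt_inv hPinv, ← hQdef, ← Matrix.mul_assoc Q, Matrix.mul_nonsing_inv Q hQdu,
      Matrix.one_mul, Matrix.nonsing_inv_mul Q hQdu] at hcong
    convert hcong using 1
    simp only [Matrix.mul_assoc]
  -- flip with `X = (Q N √C₂)ᵀ`
  have hC₂T : (CFC.sqrt C₂)ᵀ = CFC.sqrt C₂ := transpose_sqrt (S := C₂)
  have hNT : Nᵀ = N := transpose_sqrt (S := M)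
  have hd3 : (1 - (Q * N * CFC.sqrt C₂)ᵀᵀ * (Q * N * CFC.sqrt C₂)ᵀ).PosDef := by
    rw [Matrix.transpose_transpose, Matrix.transpose_mul, Matrix.transpose_mul, hC₂T, hNT, hQT]
    convert hd2 using 1
    rw [Matrix.mul_assoc (Q * N) (CFC.sqrt C₂), ← Matrix.mul_assoc (CFC.sqrt C₂),
      CFC.sqrt_mul_sqrt_self C₂ hC₂.nonneg]
    simp only [Matrix.mul_assoc]
  have hflip := posDef_one_sub_mul_transpose hd3
  rw [Matrix.transpose_transpose, Matrix.transpose_mul, Matrix.transpose_mul, hC₂T, hNT, hQT] at hflip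
  rw [hM']
  convert hflip using 1
  rw [← hQQ]
  simp only [Matrix.mul_assoc]

/-! ### Along the whole flow -/

/-- **Every stage of the regulator flow is a subcritical positive semidefinite regulator.** For
`Cⱼ ⪰ 0` (`j < n`), `M ⪰ 0` and global subcriticality `1 − √C M √C ≻ 0`, `C = Σ_{j<n} Cⱼ`: for every
`j ≤ n`, `Mⱼ = regFlow C M j ⪰ 0` and `1 − √Tⱼ Mⱼ √Tⱼ ≻ 0` with `Tⱼ = Σ_{j ≤ i < n} Cᵢ` the covariance
still to be integrated. [folklore] -/
theorem regFlow_posSemidef_and_subcritical (C : ℕ → Matrix ι ι ℝ) (M : Matrix ι ι ℝ) (n : ℕ)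
    (hC : ∀ j < n, (C j).PosSemidef) (hM : M.PosSemidef)
    (h : (1 - CFC.sqrt (∑ j ∈ Finset.range n, C j) * M * CFC.sqrt (∑ j ∈ Finset.range n, C j)).PosDef) :
    ∀ j ≤ n, (regFlow C M j).PosSemidef ∧
      (1 - CFC.sqrt (∑ i ∈ Finset.Ico j n, C i) * regFlow C M j *
        CFC.sqrt (∑ i ∈ Finset.Ico j n, C i)).PosDef := by
  intro j
  induction j with
  | zero =>
    intro _
    rw [regFlow_zero, ← Finset.range_eq_Ico]
    exact ⟨hM, h⟩
  | succ j ih =>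
    intro hj
    have hjn : j < n := Nat.lt_of_succ_le hj
    obtain ⟨hMj, hsub⟩ := ih hjn.le
    rw [Finset.sum_eq_sum_Ico_succ_bot hjn] at hsub
    have hT : (∑ i ∈ Finset.Ico (j + 1) n, C i).PosSemidef :=
      posSemidef_sum _ fun i hi => hC i (Finset.mem_Ico.1 hi).2
    obtain ⟨-, -, hc, hd⟩ := regulator_step (hC j hjn) hT hMj hsub
    exact ⟨by rw [regFlow_succ]; exact hc, by rw [regFlow_succ]; exact hd⟩

/-- **Per-scale applicability**: under the same hypotheses, at every scale `j < n` the Gaussian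
integral of `GaussianQuadraticTilt` applies (`1 − √Cⱼ Mⱼ √Cⱼ ≻ 0`) and the step of
`RegulatorRenormalisation.prod_det_regFlow` is invertible (`det(1 − CⱼMⱼ)` a unit). [folklore] -/
theorem regFlow_step_subcritical (C : ℕ → Matrix ι ι ℝ) (M : Matrix ι ι ℝ) (n : ℕ)
    (hC : ∀ j < n, (C j).PosSemidef) (hM : M.PosSemidef)
    (h : (1 - CFC.sqrt (∑ j ∈ Finset.range n, C j) * M * CFC.sqrt (∑ j ∈ Finset.range n, C j)).PosDef)
    {j : ℕ} (hj : j < n) :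
    (1 - CFC.sqrt (C j) * regFlow C M j * CFC.sqrt (C j)).PosDef ∧ IsUnit (1 - C j * regFlow C M j).det := by
  obtain ⟨hMj, hsub⟩ := regFlow_posSemidef_and_subcritical C M n hC hM h j hj.le
  rw [Finset.sum_eq_sum_Ico_succ_bot hj] at hsub
  have hT : (∑ i ∈ Finset.Ico (j + 1) n, C i).PosSemidef :=
    posSemidef_sum _ fun i hi => hC i (Finset.mem_Ico.1 hi).2
  obtain ⟨ha, hb, -, -⟩ := regulator_step (hC j hj) hT hMj hsub
  exact ⟨ha, hb⟩

/-- **The distributed determinant, unconditionally in the subcritical class**: with the hypotheses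
above, `Π_{j<n} det(1 − CⱼMⱼ) = det(1 − CM)` and every factor is positive. [folklore] -/
theorem prod_det_regFlow_of_subcritical (C : ℕ → Matrix ι ι ℝ) (M : Matrix ι ι ℝ) (n : ℕ)
    (hC : ∀ j < n, (C j).PosSemidef) (hM : M.PosSemidef)
    (h : (1 - CFC.sqrt (∑ j ∈ Finset.range n, C j) * M * CFC.sqrt (∑ j ∈ Finset.range n, C j)).PosDef) :
    ∏ j ∈ Finset.range n, (1 - C j * regFlow C M j).det = (1 - (∑ j ∈ Finset.range n, C j) * M).det ∧
      ∀ j < n, 0 < (1 - C j * regFlow C M j).det := by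
  refine ⟨prod_det_regFlow C M n fun j hj => (regFlow_step_subcritical C M n hC hM h hj).2, fun j hj => ?_⟩
  rw [det_one_sub_mul_eq_det_one_sub_sqrt_mul_sqrt (hC j hj)]
  exact (regFlow_step_subcritical C M n hC hM h hj).1.det_pos


/-! ### Quantitative version: an `ε`-margin of subcriticality propagates, and the `ε^{rank}` bound -/

/-- **The flip with a margin** (positive semidefinite form): for a real square `X` and `a ∈ ℝ`,
`a·1 − XᵀX ⪰ 0 ⟹ a·1 − XXᵀ ⪰ 0`. [folklore] -/
theorem posSemidef_smul_one_sub_mul_transpose {X : Matrix ι ι ℝ} {a : ℝ}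
    (h : (a • (1 : Matrix ι ι ℝ) - Xᵀ * X).PosSemidef) : (a • (1 : Matrix ι ι ℝ) - X * Xᵀ).PosSemidef := by
  have hyp : ∀ z : ι → ℝ, (X *ᵥ z) ⬝ᵥ (X *ᵥ z) ≤ a * (z ⬝ᵥ z) := fun z => by
    have h1 := h.dotProduct_mulVec_nonneg z
    rw [star_trivial, Matrix.sub_mulVec, Matrix.smul_mulVec, Matrix.one_mulVec, dotProduct_sub,
      dotProduct_smul, smul_eq_mul, ← Matrix.mulVec_mulVec, Matrix.dotProduct_mulVec z Xᵀ,
      ← Matrix.mulVec_transpose, Matrix.transpose_transpose] at h1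
    linarith
  have hnn : ∀ v : ι → ℝ, 0 ≤ v ⬝ᵥ v := fun v => Finset.sum_nonneg fun i _ => mul_self_nonneg (v i)
  refine Matrix.PosSemidef.of_dotProduct_mulVec_nonneg ?_ fun y => ?_
  · rw [Matrix.IsHermitian, Matrix.conjTranspose_eq_transpose_of_trivial, Matrix.transpose_sub,
      Matrix.transpose_smul, Matrix.transpose_one, Matrix.transpose_mul, Matrix.transpose_transpose]
  rw [star_trivial, Matrix.sub_mulVec, Matrix.smul_mulVec, Matrix.one_mulVec, dotProduct_sub,
    dotProduct_smul, smul_eq_mul, ← transpose_mulVec_dotProduct_self, sub_nonneg]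
  set z := Xᵀ *ᵥ y with hz
  by_cases hz0 : z ⬝ᵥ z = 0
  · rw [hz0]
    have ha : 0 ≤ a * (z ⬝ᵥ z) := (hnn _).trans (hyp z)
    rcases (hnn y).eq_or_lt with hy | hy
    · -- `y·y = 0`: then `a·(y·y) = 0 ≥ 0`
      rw [← hy, mul_zero]
    · -- `a ≥ 0` from `0 ≤ (Xz)·(Xz) ≤ a (z·z)` unless `z·z = 0`; here use `y`: `0 ≤ (Xy')…`; simplest:
      -- from `hyp y`: `(Xy)·(Xy) ≤ a (y·y)` and `(Xy)·(Xy) ≥ 0`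
      nlinarith [hyp y, hnn (X *ᵥ y)]
  · have hzpos : 0 < z ⬝ᵥ z := lt_of_le_of_ne (hnn z) (Ne.symm hz0)
    have hzz : z ⬝ᵥ z = y ⬝ᵥ (X *ᵥ z) := by
      rw [hz, Matrix.dotProduct_mulVec y X, ← Matrix.mulVec_transpose]
    have hCS := dotProduct_mulVec_sq_le (P := (1 : Matrix ι ι ℝ)) Matrix.transpose_one
      (fun v => by rw [Matrix.one_mulVec]; exact hnn v) y (X *ᵥ z)
    simp only [Matrix.one_mulVec] at hCS
    rw [← hzz] at hCS
    -- `(z·z)² ≤ (y·y)·(Xz·Xz) ≤ (y·y)·a·(z·z)` ⟹ `z·z ≤ a·(y·y)`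
    have h2 : (z ⬝ᵥ z) ^ 2 ≤ (y ⬝ᵥ y) * (a * (z ⬝ᵥ z)) :=
      hCS.trans (mul_le_mul_of_nonneg_left (hyp z) (hnn y))
    nlinarith

/-- `ε`-**subcriticality in the two symmetric forms**: for `C, M ⪰ 0` and `a ∈ ℝ`,
`a·1 − √C M √C ⪰ 0 ⟹ a·1 − √M C √M ⪰ 0`. [folklore] -/
theorem posSemidef_smul_one_sub_sqrt_mul_sqrt_symm {C M : Matrix ι ι ℝ} {a : ℝ} (hC : C.PosSemidef)
    (hM : M.PosSemidef) (h : (a • (1 : Matrix ι ι ℝ) - CFC.sqrt C * M * CFC.sqrt C).PosSemidef) :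
    (a • (1 : Matrix ι ι ℝ) - CFC.sqrt M * C * CFC.sqrt M).PosSemidef := by
  rw [sqrt_mul_mul_sqrt_eq_transpose_mul_self hM] at h
  rw [← mul_self_transpose_eq_sqrt_mul_mul_sqrt hC]
  exact posSemidef_smul_one_sub_mul_transpose h

/-- **The `ε`-margin is monotone in the covariance**: `0 ⪯ C₁ ⪯ C`, `M ⪰ 0`,
`a·1 − √C M √C ⪰ 0 ⟹ a·1 − √C₁ M √C₁ ⪰ 0`. [folklore] -/
theorem posSemidef_smul_one_sub_sqrt_mul_sqrt_mono {C C₁ M : Matrix ι ι ℝ} {a : ℝ} (hC₁ : C₁.PosSemidef)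
    (hCC₁ : (C - C₁).PosSemidef) (hM : M.PosSemidef)
    (h : (a • (1 : Matrix ι ι ℝ) - CFC.sqrt C * M * CFC.sqrt C).PosSemidef) :
    (a • (1 : Matrix ι ι ℝ) - CFC.sqrt C₁ * M * CFC.sqrt C₁).PosSemidef := by
  have hC : C.PosSemidef := by
    have := hC₁.add hCC₁
    rwa [add_sub_cancel] at this
  have h1 := posSemidef_smul_one_sub_sqrt_mul_sqrt_symm hC hM h
  have h2 : (a • (1 : Matrix ι ι ℝ) - CFC.sqrt M * C₁ * CFC.sqrt M).PosSemidef := by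
    have hpsd : ((CFC.sqrt M)ᴴ * (C - C₁) * CFC.sqrt M).PosSemidef := hCC₁.conjTranspose_mul_mul_same _
    rw [conjTranspose_cfcSqrt] at hpsd
    have := h1.add hpsd
    convert this using 1
    rw [Matrix.mul_sub, Matrix.sub_mul]
    abel
  exact posSemidef_smul_one_sub_sqrt_mul_sqrt_symm hM hC₁ h2

/-- **The renormalisation step keeps the `ε`-margin.** For `C₁, C₂, M ⪰ 0`, `0 ≤ ε < 1`, global
subcriticality `1 − √(C₁+C₂) M √(C₁+C₂) ≻ 0` with margin `(1−ε)·1 − √(C₁+C₂) M √(C₁+C₂) ⪰ 0`,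
the renormalised regulator `M′ = M(1 − C₁M)⁻¹` satisfies `(1−ε)·1 − √C₂ M′ √C₂ ⪰ 0`. [folklore] -/
theorem regulator_step_margin {C₁ C₂ M : Matrix ι ι ℝ} {ε : ℝ} (hC₁ : C₁.PosSemidef) (hC₂ : C₂.PosSemidef)
    (hM : M.PosSemidef) (hε0 : 0 ≤ ε) (h : (1 - CFC.sqrt (C₁ + C₂) * M * CFC.sqrt (C₁ + C₂)).PosDef)
    (hle : ((1 - ε) • (1 : Matrix ι ι ℝ) - CFC.sqrt (C₁ + C₂) * M * CFC.sqrt (C₁ + C₂)).PosSemidef) :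
    ((1 - ε) • (1 : Matrix ι ι ℝ) - CFC.sqrt C₂ * (M * (1 - C₁ * M)⁻¹) * CFC.sqrt C₂).PosSemidef := by
  obtain ⟨ha, -, -, -⟩ := regulator_step hC₁ hC₂ hM h
  set N := CFC.sqrt M with hNdef
  have hNN : N * N = M := CFC.sqrt_mul_sqrt_self M hM.nonneg
  have hNH : Nᴴ = N := conjTranspose_cfcSqrt M
  have hNT : Nᵀ = N := transpose_sqrt (S := M)
  have hP : (1 - N * C₁ * N).PosDef := posDef_one_sub_sqrt_mul_sqrt_symm hC₁ hM ha
  have hPu : IsUnit (1 - N * C₁ * N).det := hP.isUnit.map Matrix.detMonoidHom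
  have hb' : IsUnit (1 - C₁ * N * N).det := by
    rw [Matrix.mul_assoc, hNN, det_one_sub_mul_eq_det_one_sub_sqrt_mul_sqrt hC₁]
    exact ha.isUnit.map Matrix.detMonoidHom
  have hM' : M * (1 - C₁ * M)⁻¹ = N * (1 - N * C₁ * N)⁻¹ * N := by
    rw [← hNN, Matrix.mul_assoc N N, ← Matrix.mul_assoc C₁ N N, mul_inv_one_sub_mul hb',
      ← Matrix.mul_assoc, ← Matrix.mul_assoc N]
  have hPinv : (1 - N * C₁ * N)⁻¹.PosDef := hP.inv
  set Q := CFC.sqrt (1 - N * C₁ * N)⁻¹ with hQdef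
  have hQQ : Q * Q = (1 - N * C₁ * N)⁻¹ := sqrt_mul_sqrt hPinv
  have hQT : Qᵀ = Q := transpose_sqrt (S := (1 - N * C₁ * N)⁻¹)
  have hQu : IsUnit Q := isUnit_sqrt hPinv
  have hQdu : IsUnit Q.det := (Matrix.isUnit_iff_isUnit_det Q).1 hQu
  have hC₁₂ : (C₁ + C₂).PosSemidef := hC₁.add hC₂
  -- the margin in `N`-form: `(1−ε)·1 − N(C₁+C₂)N ⪰ 0`
  have hglob : ((1 - ε) • (1 : Matrix ι ι ℝ) - N * (C₁ + C₂) * N).PosSemidef :=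
    posSemidef_smul_one_sub_sqrt_mul_sqrt_symm hC₁₂ hM hle
  -- `(1−ε)·(P⁻¹)⁻¹ − N C₂ N = [(1−ε)·1 − N(C₁+C₂)N] + ε·(N C₁ N) ⪰ 0`
  have hd1 : ((1 - ε) • (1 - N * C₁ * N)⁻¹⁻¹ - N * C₂ * N).PosSemidef := by
    rw [Matrix.nonsing_inv_nonsing_inv _ hPu]
    have hextra : (ε • (N * C₁ * N)).PosSemidef := by
      have h0 : (Nᴴ * C₁ * N).PosSemidef := hC₁.conjTranspose_mul_mul_same N
      rw [hNH] at h0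
      exact h0.smul hε0
    have := hglob.add hextra
    convert this using 1
    simp only [smul_sub, sub_smul, one_smul, Matrix.mul_add, Matrix.add_mul]
    abel
  -- congruence by `Q`: `(1−ε)·1 − Q N C₂ N Q ⪰ 0`
  have hd2 : ((1 - ε) • (1 : Matrix ι ι ℝ) - Q * N * C₂ * N * Q).PosSemidef := by
    have hcong := hd1.conjTranspose_mul_mul_same Q
    rw [Matrix.conjTranspose_eq_transpose_of_trivial, hQT, Matrix.mul_sub, Matrix.sub_mul,
      Matrix.mul_smul, Matrix.smul_mul, ← sqrt_inv_mul_sqrt_inv hPinv, ← hQdef, ← Matrix.mul_assoc Q,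
      Matrix.mul_nonsing_inv Q hQdu, Matrix.one_mul, Matrix.nonsing_inv_mul Q hQdu] at hcong
    convert hcong using 1
    simp only [Matrix.mul_assoc]
  -- flip with `X = (Q N √C₂)ᵀ`
  have hC₂T : (CFC.sqrt C₂)ᵀ = CFC.sqrt C₂ := transpose_sqrt (S := C₂)
  have hd3 : ((1 - ε) • (1 : Matrix ι ι ℝ) -
      (Q * N * CFC.sqrt C₂)ᵀᵀ * (Q * N * CFC.sqrt C₂)ᵀ).PosSemidef := by
    rw [Matrix.transpose_transpose, Matrix.transpose_mul, Matrix.transpose_mul, hC₂T, hNT, hQT]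
    convert hd2 using 1
    rw [Matrix.mul_assoc (Q * N) (CFC.sqrt C₂), ← Matrix.mul_assoc (CFC.sqrt C₂),
      CFC.sqrt_mul_sqrt_self C₂ hC₂.nonneg]
    simp only [Matrix.mul_assoc]
  have hflip := posSemidef_smul_one_sub_mul_transpose hd3
  rw [Matrix.transpose_transpose, Matrix.transpose_mul, Matrix.transpose_mul, hC₂T, hNT, hQT] at hflip
  rw [hM']
  convert hflip using 1
  rw [← hQQ]
  simp only [Matrix.mul_assoc]

/-- **The `ε`-margin along the whole flow**: with `Cⱼ ⪰ 0`, `M ⪰ 0`, `0 ≤ ε`, global subcriticality and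
global margin `(1−ε)·1 − √C M √C ⪰ 0` (`C = Σ_{j<n}Cⱼ`), every stage keeps the margin for the tail
covariance: `(1−ε)·1 − √Tⱼ Mⱼ √Tⱼ ⪰ 0`, `Tⱼ = Σ_{j≤i<n}Cᵢ`. [folklore] -/
theorem regFlow_margin (C : ℕ → Matrix ι ι ℝ) (M : Matrix ι ι ℝ) (n : ℕ) {ε : ℝ}
    (hC : ∀ j < n, (C j).PosSemidef) (hM : M.PosSemidef) (hε0 : 0 ≤ ε)
    (h : (1 - CFC.sqrt (∑ j ∈ Finset.range n, C j) * M * CFC.sqrt (∑ j ∈ Finset.range n, C j)).PosDef)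
    (hle : ((1 - ε) • (1 : Matrix ι ι ℝ) -
      CFC.sqrt (∑ j ∈ Finset.range n, C j) * M * CFC.sqrt (∑ j ∈ Finset.range n, C j)).PosSemidef) :
    ∀ j ≤ n, ((1 - ε) • (1 : Matrix ι ι ℝ) - CFC.sqrt (∑ i ∈ Finset.Ico j n, C i) * regFlow C M j *
        CFC.sqrt (∑ i ∈ Finset.Ico j n, C i)).PosSemidef := by
  intro j
  induction j with
  | zero =>
    intro _
    rw [regFlow_zero, ← Finset.range_eq_Ico]
    exact hle
  | succ j ih =>
    intro hj
    have hjn : j < n := Nat.lt_of_succ_le hj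
    have hmar := ih hjn.le
    obtain ⟨hMj, hsub⟩ := regFlow_posSemidef_and_subcritical C M n hC hM h j hjn.le
    rw [Finset.sum_eq_sum_Ico_succ_bot hjn] at hsub hmar
    have hT : (∑ i ∈ Finset.Ico (j + 1) n, C i).PosSemidef :=
      posSemidef_sum _ fun i hi => hC i (Finset.mem_Ico.1 hi).2
    rw [regFlow_succ]
    exact regulator_step_margin (hC j hjn) hT hMj hε0 hsub hmar

/-- Per scale: `(1−ε)·1 − √Cⱼ Mⱼ √Cⱼ ⪰ 0` for every `j < n`. [folklore] -/
theorem regFlow_step_margin (C : ℕ → Matrix ι ι ℝ) (M : Matrix ι ι ℝ) (n : ℕ) {ε : ℝ}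
    (hC : ∀ j < n, (C j).PosSemidef) (hM : M.PosSemidef) (hε0 : 0 ≤ ε)
    (h : (1 - CFC.sqrt (∑ j ∈ Finset.range n, C j) * M * CFC.sqrt (∑ j ∈ Finset.range n, C j)).PosDef)
    (hle : ((1 - ε) • (1 : Matrix ι ι ℝ) -
      CFC.sqrt (∑ j ∈ Finset.range n, C j) * M * CFC.sqrt (∑ j ∈ Finset.range n, C j)).PosSemidef)
    {j : ℕ} (hj : j < n) :
    ((1 - ε) • (1 : Matrix ι ι ℝ) - CFC.sqrt (C j) * regFlow C M j * CFC.sqrt (C j)).PosSemidef := by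
  have hmar := regFlow_margin C M n hC hM hε0 h hle j hj.le
  obtain ⟨hMj, -⟩ := regFlow_posSemidef_and_subcritical C M n hC hM h j hj.le
  rw [Finset.sum_eq_sum_Ico_succ_bot hj] at hmar
  have hT : (∑ i ∈ Finset.Ico (j + 1) n, C i).PosSemidef :=
    posSemidef_sum _ fun i hi => hC i (Finset.mem_Ico.1 hi).2
  exact posSemidef_smul_one_sub_sqrt_mul_sqrt_mono (hC j hj) (by rwa [add_sub_cancel_left]) hMj hmar

/-- **The `ε^{rank}` bound for a possibly singular covariance**: for `C, M ⪰ 0`, `0 < ε ≤ 1`,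
`(1−ε)·1 − √C M √C ⪰ 0` and `rank M ≤ k`: `ε^k ≤ det(1 − CM)` (the tree's
`DeterminantLowRankDefect.det_one_sub_ge_pow` at `P = √C M √C`, `rank P ≤ rank M`). [folklore] -/
theorem pow_le_det_one_sub_mul {C M : Matrix ι ι ℝ} {ε : ℝ} {k : ℕ} (hC : C.PosSemidef) (hM : M.PosSemidef)
    (hε : 0 < ε) (hε1 : ε ≤ 1)
    (hle : ((1 - ε) • (1 : Matrix ι ι ℝ) - CFC.sqrt C * M * CFC.sqrt C).PosSemidef) (hrank : M.rank ≤ k) :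
    ε ^ k ≤ (1 - C * M).det := by
  rw [det_one_sub_mul_eq_det_one_sub_sqrt_mul_sqrt hC]
  refine Literature.LinearAlgebra.Matrix.det_one_sub_ge_pow ?_ hε hε1 hle ?_
  · have h0 := hM.conjTranspose_mul_mul_same (CFC.sqrt C)
    rwa [conjTranspose_cfcSqrt] at h0
  · exact ((Matrix.rank_mul_le_left _ _).trans (Matrix.rank_mul_le_right _ _)).trans hrank


/-! ### Merging two regulators never loses (regulator form of the determinant defect inequality) -/

/-- **Merging monotonicity in regulator language**: for `C, M_X, M_Y ⪰ 0` with the merged regulator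
subcritical, `1 − √C (M_X + M_Y) √C ≻ 0`:
`det(1 − C(M_X + M_Y)) ≤ det(1 − CM_X)·det(1 − CM_Y)`
(so the normalisation `det(1 − C(M_X+M_Y))^{−1/2}` of the merged regulator dominates the product of the
separate ones — exact equality when `M_X C M_Y = 0`, `RegulatorRenormalisation`). From the tree's
`DeterminantDefectInequality.det_one_sub_sub_le` at `A = √C M_X √C`, `B = √C M_Y √C`. [folklore] -/
theorem det_one_sub_mul_add_le {C X Y : Matrix ι ι ℝ} (hC : C.PosSemidef) (hX : X.PosSemidef)
    (hY : Y.PosSemidef) (h : (1 - CFC.sqrt C * (X + Y) * CFC.sqrt C).PosDef) :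
    (1 - C * (X + Y)).det ≤ (1 - C * X).det * (1 - C * Y).det := by
  have hsq : (CFC.sqrt C)ᴴ = CFC.sqrt C := conjTranspose_cfcSqrt C
  have hA : (CFC.sqrt C * X * CFC.sqrt C).PosSemidef := by
    have h0 := hX.conjTranspose_mul_mul_same (CFC.sqrt C); rwa [hsq] at h0
  have hB : (CFC.sqrt C * Y * CFC.sqrt C).PosSemidef := by
    have h0 := hY.conjTranspose_mul_mul_same (CFC.sqrt C); rwa [hsq] at h0
  have hAB : (1 - CFC.sqrt C * X * CFC.sqrt C - CFC.sqrt C * Y * CFC.sqrt C).PosDef := by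
    convert h using 1
    rw [Matrix.mul_add, Matrix.add_mul]
    abel
  rw [det_one_sub_mul_eq_det_one_sub_sqrt_mul_sqrt hC, det_one_sub_mul_eq_det_one_sub_sqrt_mul_sqrt hC,
    det_one_sub_mul_eq_det_one_sub_sqrt_mul_sqrt hC, Matrix.mul_add, Matrix.add_mul, ← sub_sub]
  exact det_one_sub_sub_le hA hB hAB

end Literature.Analysis.Matrix
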